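import Mathlib.MeasureTheory.Function.UniformIntegrable
import Literature.MathematicalPhysics.KineticTheory.InfiniteChainCorrelationContinuity
import Literature.MathematicalPhysics.KineticTheory.InfiniteChainEnergyDensityMoments
import HarnessLib

/-!
# Continuity in time of two-point functions along a measure-preserving dynamics (general observables)

Topic `Literature/MathematicalPhysics/KineticTheory` (companion of `InfiniteChainCorrelationContinuity`,
which treats the current–current terms). For an infinite-volume dynamics `D : InfiniteChainDynamics P`
preserving a probability measure `μ` and two observables `f, g ∈ L⁴(μ)` such that `t ↦ g(φ_t σ)` is
continuous for every `σ` in the carrier, the two-point function `t ↦ ∫ f · (g ∘ φ_t) dμ` is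
continuous on `ℝ` (`continuous_integral_mul_comp_flow`): the integrands are equi-integrable
(`2f²(g∘φ_t)² ≤ f⁴ + (g∘φ_t)⁴`, invariance, de la Vallée-Poussin
`Literature.Analysis.FunctionSpaces.unifIntegrable_of_lintegral_superlinear_le`) and converge
pointwise a.e. along every sequence of times (Vitali, `MeasureTheory.tendsto_Lp_finite_of_tendsto_ae`).
Instances: the ENERGY-DENSITY terms `t ↦ ∫ h_y (h_x ∘ φ_t) dμ` and the mixed terms with the current,
under Buttà–Marchioro's superstability estimate (2.3) (`0 ≤ h_x ≤ 2W_{x,1}` gives all moments), i.e.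
the termwise input for the continuity at `t = 0` of BOTH generators' summed autocorrelations in
`ZeroWavenumberData.isStronglyContinuous_of_generators` (also in the translated form
`t ↦ ∫ h₀ · (h₀ ∘ τ_x ∘ φ_t) dμ`, `continuous_integral_energyDensityZ_mul_chainShift_flow`).
Everything is proved; tagged `[folklore]`. No definitions, no named facts.
-/

noncomputable section

open MeasureTheory Filter Set Function
open scoped Topology ENNReal

namespace Literature.MathematicalPhysics.KineticTheory.HeatConduction

namespace InfiniteChainDynamics

variable {P : OscillatorChain} (D : InfiniteChainDynamics P)

/-- **Uniform second moments of `f · (g ∘ φ)`** for `f, g ∈ L⁴(μ)` and `φ` preserving `μ`: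
`∫ (f (g∘φ))² dμ ≤ (∫ f⁴ + ∫ g⁴)/2`. [folklore] -/
theorem integral_sq_mul_comp_le {μ : Measure ChainConfig} {f g : ChainConfig → ℝ} (hfm : Measurable f)
    (hgm : Measurable g) (hf4 : Integrable (fun σ => f σ ^ 4) μ) (hg4 : Integrable (fun σ => g σ ^ 4) μ)
    {φ : ChainConfig → ChainConfig} (hφ : MeasurePreserving φ μ μ) :
    Integrable (fun σ => (f σ * g (φ σ)) ^ 2) μ ∧
      ∫ σ, (f σ * g (φ σ)) ^ 2 ∂μ ≤ ((∫ σ, f σ ^ 4 ∂μ) + ∫ σ, g σ ^ 4 ∂μ) / 2 := by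
  have hg4φ : Integrable (fun σ => g (φ σ) ^ 4) μ := hφ.integrable_comp_of_integrable hg4
  have heq : ∫ σ, g (φ σ) ^ 4 ∂μ = ∫ σ, g σ ^ 4 ∂μ := by
    have h := integral_map (μ := μ) hφ.measurable.aemeasurable (f := fun σ => g σ ^ 4)
      (by rw [hφ.map_eq]; exact (hgm.pow_const 4).aestronglyMeasurable)
    rw [hφ.map_eq] at h
    exact h.symm
  have hdom : Integrable (fun σ => (f σ ^ 4 + g (φ σ) ^ 4) / 2) μ := (hf4.add hg4φ).div_const 2
  have hpt : ∀ σ, (f σ * g (φ σ)) ^ 2 ≤ (f σ ^ 4 + g (φ σ) ^ 4) / 2 := by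
    intro σ
    rw [mul_pow]
    have h := two_mul_le_add_sq (f σ ^ 2) (g (φ σ) ^ 2)
    nlinarith
  have hmeas : AEStronglyMeasurable (fun σ => (f σ * g (φ σ)) ^ 2) μ :=
    ((hfm.mul (hgm.comp hφ.measurable)).pow_const 2).aestronglyMeasurable
  have hint : Integrable (fun σ => (f σ * g (φ σ)) ^ 2) μ := by
    refine hdom.mono' hmeas (Eventually.of_forall fun σ => ?_)
    rw [Real.norm_of_nonneg (sq_nonneg _)]
    exact hpt σ
  refine ⟨hint, ?_⟩
  calc ∫ σ, (f σ * g (φ σ)) ^ 2 ∂μ ≤ ∫ σ, (f σ ^ 4 + g (φ σ) ^ 4) / 2 ∂μ := integral_mono hint hdom hpt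
    _ = ((∫ σ, f σ ^ 4 ∂μ) + ∫ σ, g (φ σ) ^ 4 ∂μ) / 2 := by rw [integral_div, integral_add hf4 hg4φ]
    _ = ((∫ σ, f σ ^ 4 ∂μ) + ∫ σ, g σ ^ 4 ∂μ) / 2 := by rw [heq]

/-- **Equi-integrability in time of `f · (g ∘ φ_t)`** for `f, g ∈ L⁴(μ)` and `D` preserving `μ`. [folklore] -/
theorem unifIntegrable_mul_comp_flow {μ : Measure ChainConfig} (hD : D.PreservesMeasure μ)
    {f g : ChainConfig → ℝ} (hfm : Measurable f) (hgm : Measurable g)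
    (hf4 : Integrable (fun σ => f σ ^ 4) μ) (hg4 : Integrable (fun σ => g σ ^ 4) μ) :
    UnifIntegrable (fun t : ℝ => fun σ => f σ * g (D.flow t σ)) 1 μ := by
  have hmeas : ∀ t : ℝ, AEStronglyMeasurable (fun σ => f σ * g (D.flow t σ)) μ := fun t =>
    (hfm.mul (hgm.comp (hD.2 t).measurable)).aestronglyMeasurable
  have hγ : Tendsto (fun u : ℝ => u ^ 2 / u) atTop atTop := by
    refine tendsto_id.congr' ?_
    filter_upwards [eventually_ne_atTop 0] with u hu
    simp only [id_eq]; field_simp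
  set M : ℝ := ((∫ σ, f σ ^ 4 ∂μ) + ∫ σ, g σ ^ 4 ∂μ) / 2
  refine Literature.Analysis.FunctionSpaces.unifIntegrable_of_lintegral_superlinear_le hmeas hγ
    (M := ENNReal.ofReal M) ENNReal.ofReal_ne_top fun t => ?_
  obtain ⟨hint, hle⟩ := integral_sq_mul_comp_le hfm hgm hf4 hg4 (hD.2 t)
  have e : ∀ σ, ‖f σ * g (D.flow t σ)‖ ^ 2 = (f σ * g (D.flow t σ)) ^ 2 := fun σ => by
    rw [Real.norm_eq_abs, sq_abs]
  simp_rw [e]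
  rw [← ofReal_integral_eq_lintegral_ofReal hint (Eventually.of_forall fun σ => sq_nonneg _)]
  exact ENNReal.ofReal_le_ofReal hle

/-- **Continuity in time of two-point functions.** For `D` preserving the probability measure `μ`,
`f, g` measurable with `f⁴, g⁴ ∈ L¹(μ)`, and `t ↦ g(φ_t σ)` continuous for every `σ` in the carrier:
`t ↦ ∫ f · (g ∘ φ_t) dμ` is continuous on `ℝ`. [folklore] -/
theorem continuous_integral_mul_comp_flow {μ : Measure ChainConfig} [IsProbabilityMeasure μ]
    (hD : D.PreservesMeasure μ) {f g : ChainConfig → ℝ} (hfm : Measurable f) (hgm : Measurable g)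
    (hf4 : Integrable (fun σ => f σ ^ 4) μ) (hg4 : Integrable (fun σ => g σ ^ 4) μ)
    (hcont : ∀ σ ∈ D.carrier, Continuous fun t : ℝ => g (D.flow t σ)) :
    Continuous fun t : ℝ => ∫ σ, f σ * g (D.flow t σ) ∂μ := by
  set F : ℝ → ChainConfig → ℝ := fun t σ => f σ * g (D.flow t σ) with hF
  have hmeas : ∀ t : ℝ, AEStronglyMeasurable (F t) μ := fun t =>
    (hfm.mul (hgm.comp (hD.2 t).measurable)).aestronglyMeasurable
  -- integrability of each `F t` from the second moments
  have hint : ∀ t : ℝ, Integrable (F t) μ := fun t => by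
    obtain ⟨h2, -⟩ := integral_sq_mul_comp_le hfm hgm hf4 hg4 (hD.2 t)
    have hm2 : MemLp (F t) 2 μ := (memLp_two_iff_integrable_sq (hmeas t)).2 h2
    exact hm2.integrable one_le_two
  have hui := D.unifIntegrable_mul_comp_flow hD hfm hgm hf4 hg4
  have hpt : ∀ᵐ σ ∂μ, Continuous fun t : ℝ => F t σ := by
    filter_upwards [hD.1] with σ hσ
    exact continuous_const.mul (hcont σ hσ)
  refine continuous_iff_seqContinuous.2 fun u t hu => ?_
  have hui' : UnifIntegrable (fun n : ℕ => F (u n)) 1 μ := fun ε hε => by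
    obtain ⟨δ, hδ, h⟩ := hui hε
    exact ⟨δ, hδ, fun n s hs hμs => h (u n) s hs hμs⟩
  have hae : ∀ᵐ σ ∂μ, Tendsto (fun n : ℕ => F (u n) σ) atTop (𝓝 (F t σ)) := by
    filter_upwards [hpt] with σ hσ
    exact (hσ.tendsto t).comp hu
  have hL1 : Tendsto (fun n : ℕ => eLpNorm (F (u n) - F t) 1 μ) atTop (𝓝 0) :=
    tendsto_Lp_finite_of_tendsto_ae le_rfl ENNReal.one_ne_top (fun n => hmeas (u n))
      (memLp_one_iff_integrable.2 (hint t)) hui' hae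
  have hL1' : Tendsto (fun n : ℕ => ∫⁻ σ, ‖F (u n) σ - F t σ‖ₑ ∂μ) atTop (𝓝 0) := by
    refine hL1.congr fun n => ?_
    rw [eLpNorm_one_eq_lintegral_enorm]
    rfl
  exact tendsto_integral_of_L1 (F t) (hint t).aestronglyMeasurable
    (Eventually.of_forall fun n => hint (u n)) hL1'

/-! ### The energy density along the flow -/

/-- **The energy density along an orbit is continuous in time** (`U`, `V` continuous). [folklore] -/
theorem continuous_energyDensityZ_flow (hUc : Continuous P.U) (hVc : Continuous P.V) {σ : ChainConfig}
    (hσ : σ ∈ D.carrier) (x : ℤ) : Continuous fun t : ℝ => P.energyDensityZ (D.flow t σ) x := by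
  have hq : ∀ i : ℤ, Continuous fun t : ℝ => (D.flow t σ i).1 := fun i =>
    continuous_fst.comp (D.continuous_flow_apply hσ i)
  have hp : ∀ i : ℤ, Continuous fun t : ℝ => (D.flow t σ i).2 := fun i =>
    continuous_snd.comp (D.continuous_flow_apply hσ i)
  unfold OscillatorChain.energyDensityZ
  exact ((((hp x).pow 2).div_const 2).add (hUc.comp (hq x))).add
    (((hVc.comp ((hq (x + 1)).sub (hq x))).add (hVc.comp ((hq x).sub (hq (x - 1))))).div_const 2)

/-- Fourth moments of the energy density under (2.3): `h_x⁴ ∈ L¹(μ)` (`0 ≤ h_x ≤ 2W_{x,1}`). [folklore] -/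
theorem _root_.Literature.MathematicalPhysics.KineticTheory.HeatConduction.OscillatorChain.HasSuperstabilityEstimate.integrable_energyDensityZ_pow_four
    {μ : Measure ChainConfig} (hss : P.HasSuperstabilityEstimate μ) (hU0 : ∀ r, 0 ≤ P.U r)
    (hV0 : ∀ r, 0 ≤ P.V r) (hUm : Measurable P.U) (hVm : Measurable P.V) (x : ℤ) :
    Integrable (fun σ => P.energyDensityZ σ x ^ 4) μ := by
  haveI : IsProbabilityMeasure μ := hss.1
  have h4 : MemLp (fun σ => P.energyDensityZ σ x) 4 μ :=
    hss.memLp_energyDensityZ hU0 hV0 hUm hVm x (by norm_num)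
  have h := h4.integrable_norm_pow' (p := 4)
  refine h.congr (Eventually.of_forall fun σ => ?_)
  simp only [Real.norm_eq_abs]
  exact Even.pow_abs (by decide) _

/-- Fourth moments of the bond current under (2.3): `j_x⁴ ∈ L¹(μ)`. [folklore] -/
theorem _root_.Literature.MathematicalPhysics.KineticTheory.HeatConduction.OscillatorChain.HasSuperstabilityEstimate.integrable_bondCurrentZ_pow_four
    {μ : Measure ChainConfig} (hss : P.HasSuperstabilityEstimate μ) {s₂ : ℕ} (h₂ : 1 ≤ s₂)
    (hU0 : ∀ r, 0 ≤ P.U r) (hUm : Measurable P.U) (hV : OscillatorChain.IsEvenPolyOfDegree P.V s₂) (x : ℤ) :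
    Integrable (fun σ => P.bondCurrentZ σ x ^ 4) μ := by
  haveI : IsProbabilityMeasure μ := hss.1
  have h4 : MemLp (fun σ => P.bondCurrentZ σ x) 4 μ := hss.memLp_bondCurrentZ h₂ hU0 hUm hV x (by norm_num)
  have h := h4.integrable_norm_pow' (p := 4)
  refine h.congr (Eventually.of_forall fun σ => ?_)
  simp only [Real.norm_eq_abs]
  exact Even.pow_abs (by decide) _

/-- **Continuity in time of the energy–energy terms** `t ↦ ∫ h_y (h_x ∘ φ_t) dμ` under (2.3) and
`D.PreservesMeasure μ` (`U ≥ 0` measurable and continuous, `V` an even non-negative polynomial). [folklore] -/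
theorem continuous_integral_energyDensityZ_mul_flow {μ : Measure ChainConfig}
    (hss : P.HasSuperstabilityEstimate μ) {s₂ : ℕ} (hU0 : ∀ r, 0 ≤ P.U r) (hUc : Continuous P.U)
    (hV : OscillatorChain.IsEvenPolyOfDegree P.V s₂) (hD : D.PreservesMeasure μ) (x y : ℤ) :
    Continuous fun t : ℝ => ∫ σ, P.energyDensityZ σ y * P.energyDensityZ (D.flow t σ) x ∂μ := by
  haveI : IsProbabilityMeasure μ := hss.1
  have hV0 : ∀ r, 0 ≤ P.V r := hV.choose_spec.2.2
  have hVc : Continuous P.V := hV.continuous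
  exact D.continuous_integral_mul_comp_flow hD (P.measurable_energyDensityZ hUc.measurable hVc.measurable y)
    (P.measurable_energyDensityZ hUc.measurable hVc.measurable x)
    (hss.integrable_energyDensityZ_pow_four hU0 hV0 hUc.measurable hVc.measurable y)
    (hss.integrable_energyDensityZ_pow_four hU0 hV0 hUc.measurable hVc.measurable x)
    fun σ hσ => D.continuous_energyDensityZ_flow hUc hVc hσ x

/-- **Continuity in time of the mixed terms** `t ↦ ∫ h_y (j_x ∘ φ_t) dμ`. [folklore] -/
theorem continuous_integral_energyDensityZ_mul_bondCurrentZ_flow {μ : Measure ChainConfig}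
    (hss : P.HasSuperstabilityEstimate μ) {s₂ : ℕ} (h₂ : 1 ≤ s₂) (hU0 : ∀ r, 0 ≤ P.U r)
    (hUc : Continuous P.U) (hV : OscillatorChain.IsEvenPolyOfDegree P.V s₂) (hD : D.PreservesMeasure μ)
    (x y : ℤ) :
    Continuous fun t : ℝ => ∫ σ, P.energyDensityZ σ y * P.bondCurrentZ (D.flow t σ) x ∂μ := by
  haveI : IsProbabilityMeasure μ := hss.1
  have hV0 : ∀ r, 0 ≤ P.V r := hV.choose_spec.2.2
  have hVc : Continuous P.V := hV.continuous
  have hVc' : Continuous (deriv P.V) := hV.contDiff_two.continuous_deriv (by norm_num)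
  exact D.continuous_integral_mul_comp_flow hD (P.measurable_energyDensityZ hUc.measurable hVc.measurable y)
    (measurable_bondCurrentZ P x)
    (hss.integrable_energyDensityZ_pow_four hU0 hV0 hUc.measurable hVc.measurable y)
    (hss.integrable_bondCurrentZ_pow_four h₂ hU0 hUc.measurable hV x)
    fun σ hσ => D.continuous_bondCurrentZ_flow hVc' hσ x

/-- **The pinned anharmonic chain**: continuity in time of the energy–energy terms (`ω₂, lam, β ≥ 0`). [folklore] -/
theorem continuous_integral_energyDensityZ_mul_flow_pinnedChain {ω₂ lam β : ℝ} (γ : ℝ) (hω : 0 ≤ ω₂)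
    (hl : 0 ≤ lam) (hβ : 0 < β) {μ : Measure ChainConfig}
    (hss : (pinnedChain ω₂ lam β γ).HasSuperstabilityEstimate μ)
    (D : InfiniteChainDynamics (pinnedChain ω₂ lam β γ)) (hD : D.PreservesMeasure μ) (x y : ℤ) :
    Continuous fun t : ℝ => ∫ σ, (pinnedChain ω₂ lam β γ).energyDensityZ σ y *
      (pinnedChain ω₂ lam β γ).energyDensityZ (D.flow t σ) x ∂μ := by
  have hUc : Continuous (pinnedChain ω₂ lam β γ).U := by
    show Continuous fun q : ℝ => ω₂ * q ^ 2 / 2 + lam * q ^ 4 / 4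
    fun_prop
  exact D.continuous_integral_energyDensityZ_mul_flow hss (OscillatorChain.pinnedChain_U_nonneg β γ hω hl) hUc
    (OscillatorChain.pinnedChain_isEvenPolyOfDegree_V ω₂ lam γ hβ) hD x y

/-! ### Translated two-point functions (the form consumed on Doyon's `ℋ₀`) -/

/-- **Continuity in time of the translated energy–energy terms** `t ↦ ∫ h₀ · (h₀ ∘ τ_x ∘ φ_t) dμ`
(`h₀ ∘ τ_x = h_x`; the termwise input of the strong-continuity criterion
`ZeroWavenumberData.isStronglyContinuous_of_generators`). [folklore] -/
theorem continuous_integral_energyDensityZ_mul_chainShift_flow {μ : Measure ChainConfig}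
    (hss : P.HasSuperstabilityEstimate μ) {s₂ : ℕ} (hU0 : ∀ r, 0 ≤ P.U r) (hUc : Continuous P.U)
    (hV : OscillatorChain.IsEvenPolyOfDegree P.V s₂) (hD : D.PreservesMeasure μ) (x : ℤ) :
    Continuous fun t : ℝ =>
      ∫ σ, P.energyDensityZ σ 0 * P.energyDensityZ (chainShift x (D.flow t σ)) 0 ∂μ := by
  simp only [OscillatorChain.energyDensityZ_chainShift]
  exact D.continuous_integral_energyDensityZ_mul_flow hss hU0 hUc hV hD (0 + x) 0

/-- **Continuity in time of the translated mixed terms** `t ↦ ∫ h₀ · (j₀ ∘ τ_x ∘ φ_t) dμ`. [folklore] -/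
theorem continuous_integral_energyDensityZ_mul_bondCurrentZ_chainShift_flow {μ : Measure ChainConfig}
    (hss : P.HasSuperstabilityEstimate μ) {s₂ : ℕ} (h₂ : 1 ≤ s₂) (hU0 : ∀ r, 0 ≤ P.U r)
    (hUc : Continuous P.U) (hV : OscillatorChain.IsEvenPolyOfDegree P.V s₂) (hD : D.PreservesMeasure μ)
    (x : ℤ) :
    Continuous fun t : ℝ =>
      ∫ σ, P.energyDensityZ σ 0 * P.bondCurrentZ (chainShift x (D.flow t σ)) 0 ∂μ := by
  simp only [OscillatorChain.bondCurrentZ_chainShift]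
  exact D.continuous_integral_energyDensityZ_mul_bondCurrentZ_flow hss h₂ hU0 hUc hV hD (0 + x) 0

/-- **The pinned anharmonic chain**: continuity in time of the translated energy–energy terms. [folklore] -/
theorem continuous_integral_energyDensityZ_mul_chainShift_flow_pinnedChain {ω₂ lam β : ℝ} (γ : ℝ)
    (hω : 0 ≤ ω₂) (hl : 0 ≤ lam) (hβ : 0 < β) {μ : Measure ChainConfig}
    (hss : (pinnedChain ω₂ lam β γ).HasSuperstabilityEstimate μ)
    (D : InfiniteChainDynamics (pinnedChain ω₂ lam β γ)) (hD : D.PreservesMeasure μ) (x : ℤ) :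
    Continuous fun t : ℝ => ∫ σ, (pinnedChain ω₂ lam β γ).energyDensityZ σ 0 *
      (pinnedChain ω₂ lam β γ).energyDensityZ (chainShift x (D.flow t σ)) 0 ∂μ := by
  simp only [OscillatorChain.energyDensityZ_chainShift]
  exact D.continuous_integral_energyDensityZ_mul_flow_pinnedChain γ hω hl hβ hss hD (0 + x) 0

end InfiniteChainDynamics

end Literature.MathematicalPhysics.KineticTheory.HeatConduction

end
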